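import Literature.Topology.FourManifolds.LatticeFormsReflectionPairsCommutators
import HarnessLib

/-!
# `SRef(Λ)` and `SRef₊(Λ)` for EVERY lattice: sorting a word in `(±2)`-reflections by sign — `Ref(Λ) = Ref₊₂(Λ)·Ref₋₂(Λ)`,
# `SRef(Λ) = ⟨σ_aσ_b⟩`, `SRef₊(Λ) = ⟨σ_aσ_b : a² = b²⟩`
# (Markman, *JEMS* (2023) §7, opening paragraph; Gritsenko–Hulek–Sankaran, *J. Algebra* 322 (2009) Thm. 1.3 (proof))

Trunk T-4MAN vocabulary. Markman (§7) defines, for an arbitrary lattice `Λ`, `Ref(Λ) = ⟨σ_v : v² = ±2⟩`, `SRef(Λ) = Ref(Λ) ∩ SO(Λ)`,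
`SRef₊(Λ) = Ref(Λ) ∩ SO₊(Λ)` and states: "The former is generated by elements, which are products of an even number of
reflections. `SRef₊(Λ)` is generated by elements, which are either products of an even number of reflections in `+2` vectors,
or products of an even number of reflections in `−2` vectors." Row g50-#4 proved both for `Λ = U^{⊕n}`, `n ≥ 3` (where
`Ref = O` by Wall). This file proves them for EVERY symmetric non-degenerate lattice, by the rewriting used in the proof of
GHS Thm. 1.3 ("the evident property `σ_uσ_v = σ_{σ_u(v)}σ_u`", row g50-#9): a `(−2)`-letter is pushed through a block of
`(+2)`-letters without changing the block (`σ_v σ_u = σ_{σ_v(u)} σ_v` keeps `v`), so every word in `(±2)`-reflections equals a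
word with all `(+2)`-letters first and all `(−2)`-letters last; the orientation character `χ` counts the `(+2)`-letters mod 2
and `det` counts all letters mod 2, so `χ = det = 1` forces both blocks to have even length, i.e. to be products of like-sign
pairs. Written for lane `lit-hodgefound` (Track 2 foundations; prover seat `lit-hodgefound-p18`, gen 50, row g50-#10).
THEOREMS ONLY — no definition, no named fact, no instance, no notation.

## Sources, verbatim

* Markman 2023 (held `paper:arxiv-1805.11574`) p. 25, §7: "Given a lattice `Λ`, let `Ref(Λ)` be the group generated by reflections
  in `+2` and `−2` vectors in `Λ`. Set `SRef(Λ) := Ref(Λ) ∩ SO(Λ)` and `SRef₊(Λ) := Ref(Λ) ∩ SO₊(Λ)`. The former is generated by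
  elements, which are products of an even number of reflections. `SRef₊(Λ)` is generated by elements, which are either
  products of an even number of reflections in `+2` vectors, or products of an even number of reflections in `−2` vectors."
* GHS 2009 (held `paper:arxiv-0810.1614`) p. 3, proof of Thm. 1.3: "Using this, and the evident property `σ_uσ_v = σ_{σ_u(v)}σ_u`,
  we can rewrite any class […] as the class of a product `σ_{a_1}⋯σ_{a_n}`, where the `(−2)`-vectors `a_i` all belong to
  different `Õ⁺(L)`-orbits."

## Contents (all proved)

* §1 (any symmetric lattice, any two signs `ε₁, ε₂`) **pushing a letter through a block**: `σ_u·(σ_{v_1}⋯σ_{v_k}) = (σ_{v_1}⋯σ_{v_k})·σ_{u′}`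
  with the SAME `ε₁`-block and `u′² = u²` (`exists_wordProd_reflection_cons_eq_append`); **sorting**: every word with letters in the
  `(2ε₁)`- and `(2ε₂)`-reflections equals a word `l₁ ++ l₂`, `l_i` in the `(2ε_i)`-reflections (`exists_wordProd_eq_wordProd_append`);
  `Ref(Λ) = Ref₊₂(Λ)·Ref₋₂(Λ)` (`IsWordIn.exists_posTwoReflections_negTwoReflections`).
* §2 (symmetric non-degenerate lattice) parity of the orientation character along a word of orientation-reversing letters;
  **`SRef(Λ) = ⟨σ_aσ_b⟩`** (`isWordIn_reflectionPairs_iff`) and **`SRef₊(Λ) = ⟨σ_aσ_b : a² = b² = ±2 like sign⟩`**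
  (`isWordIn_likeSignReflectionPairs_iff`) for every lattice.
-/

noncomputable section

open Module
open LinearMap (BilinForm)
open LinearMap.BilinForm
open LinearMap.BilinForm (IsometryEquiv)

namespace Literature.Topology.FourManifolds

universe u

/-! ### §1 Sorting a word in reflections by sign (any symmetric lattice) -/

section Sorting

variable {W : Type*} [AddCommGroup W] {B : BilinForm ℤ W}

/-- **Pushing one reflection through a block of reflections of the other sign**: for `u² = 2ε₂` and letters `σ_{v_i}`, `v_i² = 2ε₁`,
`σ_u` followed by `σ_{v_1}, …, σ_{v_k}` equals `σ_{v_1}, …, σ_{v_k}` followed by `σ_{u′}` for some `u′` with `u′² = 2ε₂` (namely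
`u′ = σ_{v_k}⋯σ_{v_1}(u)`; each step is "the evident property `σ_uσ_v = σ_{σ_u(v)}σ_u`"). [cite: GritsenkoHulekSankaran2009, Thm. 1.3 (proof)] -/
theorem exists_wordProd_reflection_cons_eq_append (hB : B.IsSymm) {ε₁ ε₂ : ℤ} (hε₁ : ε₁ * ε₁ = 1) (hε₂ : ε₂ * ε₂ = 1)
    (m : List (B.IsometryEquiv B))
    (hm : ∀ s ∈ m, s ∈ {ψ : B.IsometryEquiv B | ∃ (r : W) (hr : B r r = ε₁ + ε₁), ψ = normTwoReflectionEquiv hB r ε₁ hr hε₁})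
    {u : W} (hu : B u u = ε₂ + ε₂) :
    ∃ (u' : W) (hu' : B u' u' = ε₂ + ε₂),
      ∀ w, wordProd (normTwoReflectionEquiv hB u ε₂ hu hε₂ :: m) w = wordProd (m ++ [normTwoReflectionEquiv hB u' ε₂ hu' hε₂]) w := by
  induction m generalizing u with
  | nil => exact ⟨u, hu, fun w ↦ rfl⟩
  | cons s m ih =>
    obtain ⟨v, hv, rfl⟩ := hm s (by simp)
    have hvu : B (normTwoReflectionEquiv hB v ε₁ hv hε₁ u) (normTwoReflectionEquiv hB v ε₁ hv hε₁ u) = ε₂ + ε₂ := by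
      rw [apply_normTwoReflectionEquiv_apply_self, hu]
    obtain ⟨u', hu', h⟩ := ih (fun s hs ↦ hm s (List.mem_cons_of_mem _ hs)) hvu
    refine ⟨u', hu', fun w ↦ ?_⟩
    rw [List.cons_append, wordProd_cons, wordProd_cons, wordProd_cons, LinearMap.BilinForm.IsometryEquiv.trans_apply,
      LinearMap.BilinForm.IsometryEquiv.trans_apply, LinearMap.BilinForm.IsometryEquiv.trans_apply, ← h, wordProd_cons,
      LinearMap.BilinForm.IsometryEquiv.trans_apply, normTwoReflectionEquiv_apply_normTwoReflectionEquiv_apply hB hv hε₁ hu hε₂ hvu]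

/-- **Sorting a word in reflections by sign**: a word whose letters are `(2ε₁)`- or `(2ε₂)`-reflections equals (pointwise) a word
`l₁ ++ l₂` with `l₁` in the `(2ε₁)`-reflections and `l₂` in the `(2ε₂)`-reflections ("we can rewrite any class as the class of
a product `σ_{a_1}⋯σ_{a_n}`" sorted by classes — here by sign, and exactly, not only modulo commutators).
[cite: GritsenkoHulekSankaran2009, Thm. 1.3 (proof)] [cite: Markman2023GeneralizedKummers, §7 (opening paragraph)] -/
theorem exists_wordProd_eq_wordProd_append (hB : B.IsSymm) {ε₁ ε₂ : ℤ} (hε₁ : ε₁ * ε₁ = 1) (hε₂ : ε₂ * ε₂ = 1)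
    (l : List (B.IsometryEquiv B))
    (hl : ∀ s ∈ l, s ∈ {ψ : B.IsometryEquiv B | ∃ (r : W) (hr : B r r = ε₁ + ε₁), ψ = normTwoReflectionEquiv hB r ε₁ hr hε₁} ∨
      s ∈ {ψ : B.IsometryEquiv B | ∃ (r : W) (hr : B r r = ε₂ + ε₂), ψ = normTwoReflectionEquiv hB r ε₂ hr hε₂}) :
    ∃ l₁ l₂ : List (B.IsometryEquiv B),
      (∀ s ∈ l₁, s ∈ {ψ : B.IsometryEquiv B | ∃ (r : W) (hr : B r r = ε₁ + ε₁), ψ = normTwoReflectionEquiv hB r ε₁ hr hε₁}) ∧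
      (∀ s ∈ l₂, s ∈ {ψ : B.IsometryEquiv B | ∃ (r : W) (hr : B r r = ε₂ + ε₂), ψ = normTwoReflectionEquiv hB r ε₂ hr hε₂}) ∧
      l₁.length + l₂.length = l.length ∧ ∀ w, wordProd l w = wordProd (l₁ ++ l₂) w := by
  induction l with
  | nil => exact ⟨[], [], by simp, by simp, rfl, fun w ↦ rfl⟩
  | cons s l ih =>
    obtain ⟨l₁, l₂, hl₁, hl₂, hlen, h⟩ := ih (fun t ht ↦ hl t (List.mem_cons_of_mem _ ht))
    rcases hl s (by simp) with hs | hs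
    · refine ⟨s :: l₁, l₂, ?_, hl₂, by simp only [List.length_cons]; omega, fun w ↦ ?_⟩
      · intro t ht
        rcases List.mem_cons.1 ht with rfl | ht
        exacts [hs, hl₁ t ht]
      · rw [List.cons_append, wordProd_cons, wordProd_cons, LinearMap.BilinForm.IsometryEquiv.trans_apply,
          LinearMap.BilinForm.IsometryEquiv.trans_apply, h]
    · obtain ⟨u, hu, rfl⟩ := hs
      obtain ⟨u', hu', h'⟩ := exists_wordProd_reflection_cons_eq_append hB hε₁ hε₂ l₁ hl₁ hu
      refine ⟨l₁, normTwoReflectionEquiv hB u' ε₂ hu' hε₂ :: l₂, hl₁, ?_, by simp only [List.length_cons]; omega, fun w ↦ ?_⟩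
      · intro t ht
        rcases List.mem_cons.1 ht with rfl | ht
        exacts [⟨u', hu', rfl⟩, hl₂ t ht]
      · have h'' := h' w
        simp only [wordProd_append_apply, wordProd_cons, wordProd_nil, LinearMap.BilinForm.IsometryEquiv.trans_apply,
          LinearMap.BilinForm.IsometryEquiv.refl_apply] at h''
        rw [wordProd_cons, LinearMap.BilinForm.IsometryEquiv.trans_apply, h]
        simp only [wordProd_append_apply, wordProd_cons, LinearMap.BilinForm.IsometryEquiv.trans_apply]
        rw [h'']

/-- **`Ref(Λ) = Ref₊₂(Λ)·Ref₋₂(Λ)`**: every word in the `(±2)`-reflections of a symmetric lattice is `φ₋ ∘ φ₊` with `φ₊` a word in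
the `(+2)`-reflections and `φ₋` a word in the `(−2)`-reflections.
[cite: GritsenkoHulekSankaran2009, Thm. 1.3 (proof)] [cite: Markman2023GeneralizedKummers, §7 (opening paragraph)] -/
theorem IsWordIn.exists_posTwoReflections_negTwoReflections (hB : B.IsSymm) {φ : B.IsometryEquiv B}
    (hφ : IsWordIn {ψ : B.IsometryEquiv B | ∃ (r : W) (ε : ℤ) (hε : ε * ε = 1) (hr : B r r = ε + ε),
      ψ = normTwoReflectionEquiv hB r ε hr hε} φ) :
    ∃ φ₁ φ₂ : B.IsometryEquiv B,
      IsWordIn {ψ : B.IsometryEquiv B | ∃ (r : W) (hr : B r r = 1 + 1), ψ = normTwoReflectionEquiv hB r 1 hr (by norm_num)} φ₁ ∧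
      IsWordIn {ψ : B.IsometryEquiv B | ∃ (r : W) (hr : B r r = -1 + -1), ψ = normTwoReflectionEquiv hB r (-1) hr (by norm_num)} φ₂ ∧
      ∀ v, φ v = φ₂ (φ₁ v) := by
  have hS : ∀ s ∈ {ψ : B.IsometryEquiv B | ∃ (r : W) (ε : ℤ) (hε : ε * ε = 1) (hr : B r r = ε + ε), ψ = normTwoReflectionEquiv hB r ε hr hε},
      s.symm ∈ {ψ : B.IsometryEquiv B | ∃ (r : W) (ε : ℤ) (hε : ε * ε = 1) (hr : B r r = ε + ε), ψ = normTwoReflectionEquiv hB r ε hr hε} := by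
    rintro s ⟨r, ε, hε, hr, rfl⟩
    rw [normTwoReflectionEquiv_symm]
    exact ⟨r, ε, hε, hr, rfl⟩
  obtain ⟨l, hl, hlφ⟩ := hφ.exists_list_of_symm_mem hS
  have hl' : ∀ s ∈ l, s ∈ {ψ : B.IsometryEquiv B | ∃ (r : W) (hr : B r r = 1 + 1), ψ = normTwoReflectionEquiv hB r 1 hr (by norm_num)} ∨
      s ∈ {ψ : B.IsometryEquiv B | ∃ (r : W) (hr : B r r = -1 + -1), ψ = normTwoReflectionEquiv hB r (-1) hr (by norm_num)} := by
    intro s hs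
    obtain ⟨r, ε, hε, hr, rfl⟩ := hl s hs
    rcases mul_self_eq_one_iff.1 hε with rfl | rfl
    exacts [Or.inl ⟨r, hr, rfl⟩, Or.inr ⟨r, hr, rfl⟩]
  obtain ⟨l₁, l₂, hl₁, hl₂, -, hsort⟩ := exists_wordProd_eq_wordProd_append hB (by norm_num) (by norm_num) l hl'
  exact ⟨wordProd l₁, wordProd l₂, ⟨l₁, fun s hs ↦ Or.inl (hl₁ s hs), fun v ↦ rfl⟩, ⟨l₂, fun s hs ↦ Or.inl (hl₂ s hs), fun v ↦ rfl⟩,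
    fun v ↦ by rw [← hlφ, hsort, wordProd_append_apply]⟩

end Sorting

/-! ### §2 `SRef(Λ) = ⟨σ_aσ_b⟩` and `SRef₊(Λ) = ⟨like-sign pairs⟩` for every symmetric non-degenerate lattice -/

section Parity

variable {W : Type*} [AddCommGroup W] [Module.Finite ℤ W] [Module.Free ℤ W] {B : BilinForm ℤ W}

/-- **The orientation character counts orientation-reversing letters mod 2**: a word all of whose letters reverse the orientation
of the positive planes lies in `O⁺` iff it has even length. [cite: GritsenkoHulekSankaran2007HM, §3 ("sn_ℝ" is a character)] [cite: Markman2023GeneralizedKummers, §7 (opening paragraph)] -/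
theorem isOrientationPreserving_wordProd_iff_even_of_forall_not (hB : B.IsSymm) (hnd : B.Nondegenerate)
    (l : List (B.IsometryEquiv B)) (hl : ∀ s ∈ l, ¬ s.IsOrientationPreserving) :
    (wordProd l).IsOrientationPreserving ↔ Even l.length := by
  induction l with
  | nil => exact iff_of_true LinearMap.BilinForm.IsometryEquiv.IsOrientationPreserving.refl (by simp)
  | cons s l ih =>
    have hs := hl s (by simp)
    rw [wordProd_cons, LinearMap.BilinForm.IsometryEquiv.isOrientationPreserving_trans_iff hB hnd,
      ih (fun t ht ↦ hl t (List.mem_cons_of_mem _ ht)), List.length_cons, Nat.even_add_one]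
    exact ⟨fun h he ↦ hs (h.1 he), fun h ↦ iff_of_false h hs⟩

/-- A word all of whose letters lie in `O⁺` lies in `O⁺`. [cite: GritsenkoHulekSankaran2007HM, §3] -/
theorem isOrientationPreserving_wordProd_of_forall (hB : B.IsSymm) (hnd : B.Nondegenerate) (l : List (B.IsometryEquiv B))
    (hl : ∀ s ∈ l, s.IsOrientationPreserving) : (wordProd l).IsOrientationPreserving :=
  IsWordIn.isOrientationPreserving (S := {s | s ∈ l}) hB hnd ⟨l, fun _ hs ↦ Or.inl hs, fun _ ↦ rfl⟩ fun s hs ↦ hl s hs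

/-- **`SRef(Λ) = ⟨σ_aσ_b⟩` for every lattice: "[`SRef(Λ) = Ref(Λ) ∩ SO(Λ)`] is generated by elements, which are products of an
even number of reflections"** — an isometry is a word in products of two `(±2)`-reflections (any signs) iff it is a word in the
`(±2)`-reflections of determinant `1`. [cite: Markman2023GeneralizedKummers, §7 (opening paragraph)] -/
theorem isWordIn_reflectionPairs_iff (hB : B.IsSymm) (φ : B.IsometryEquiv B) :
    IsWordIn {χ : B.IsometryEquiv B | ∃ (a b : W) (ε₁ ε₂ : ℤ) (hε₁ : ε₁ * ε₁ = 1) (hε₂ : ε₂ * ε₂ = 1) (ha : B a a = ε₁ + ε₁)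
        (hb : B b b = ε₂ + ε₂), χ = (normTwoReflectionEquiv hB a ε₁ ha hε₁).trans (normTwoReflectionEquiv hB b ε₂ hb hε₂)} φ ↔
      IsWordIn {ψ : B.IsometryEquiv B | ∃ (r : W) (ε : ℤ) (hε : ε * ε = 1) (hr : B r r = ε + ε), ψ = normTwoReflectionEquiv hB r ε hr hε} φ ∧
        LinearMap.det (φ : W →ₗ[ℤ] W) = 1 := by
  constructor
  · intro hφ
    refine ⟨hφ.bind fun χ hχ ↦ ?_, hφ.det_eq_one fun s hs ↦ ?_⟩
    · obtain ⟨a, b, ε₁, ε₂, hε₁, hε₂, ha, hb, rfl⟩ := hχ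
      refine IsWordIn.trans ?_ ?_
      · exact IsWordIn.of_mem ⟨a, ε₁, hε₁, ha, rfl⟩
      · exact IsWordIn.of_mem ⟨b, ε₂, hε₂, hb, rfl⟩
    · obtain ⟨a, b, ε₁, ε₂, hε₁, hε₂, ha, hb, rfl⟩ := hs
      rw [IsometryEquiv.det_trans_eq_mul, det_normTwoReflectionEquiv _ hB, det_normTwoReflectionEquiv _ hB]
      norm_num
  · rintro ⟨hφ, hdet⟩
    obtain ⟨hS, hSdet⟩ := reflections_symm_mem_and_det' hB
    refine (hφ.pairs_of_det_eq_one hS hSdet hdet).mono ?_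
    rintro χ ⟨s, ⟨a, ε₁, hε₁, ha, rfl⟩, t, ⟨b, ε₂, hε₂, hb, rfl⟩, rfl⟩
    exact ⟨a, b, ε₁, ε₂, hε₁, hε₂, ha, hb, rfl⟩

/-- **`SRef₊(Λ) = ⟨σ_aσ_b : a² = b² = +2 or a² = b² = −2⟩` for every lattice: "`SRef₊(Λ)` is generated by elements, which are either
products of an even number of reflections in `+2` vectors, or products of an even number of reflections in `−2` vectors"** — for a
symmetric non-degenerate lattice, an isometry is a word in products of two LIKE-SIGN `(±2)`-reflections iff it is a word in the
`(±2)`-reflections lying in `O⁺` with determinant `1`. (Proof: sort the word by sign, §1; `χ` is the parity of the `(+2)`-letters,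
`det` the parity of all letters.) [cite: Markman2023GeneralizedKummers, §7 (opening paragraph)] [cite: GritsenkoHulekSankaran2009, Thm. 1.3 (proof)] -/
theorem isWordIn_likeSignReflectionPairs_iff (hB : B.IsSymm) (hnd : B.Nondegenerate) (φ : B.IsometryEquiv B) :
    IsWordIn {χ : B.IsometryEquiv B | ∃ (ε : ℤ) (hε : ε * ε = 1) (a b : W) (ha : B a a = ε + ε) (hb : B b b = ε + ε),
        χ = (normTwoReflectionEquiv hB a ε ha hε).trans (normTwoReflectionEquiv hB b ε hb hε)} φ ↔
      IsWordIn {ψ : B.IsometryEquiv B | ∃ (r : W) (ε : ℤ) (hε : ε * ε = 1) (hr : B r r = ε + ε), ψ = normTwoReflectionEquiv hB r ε hr hε} φ ∧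
        φ.IsOrientationPreserving ∧ LinearMap.det (φ : W →ₗ[ℤ] W) = 1 := by
  constructor
  · intro hφ
    refine ⟨hφ.bind fun χ hχ ↦ ?_, hφ.isOrientationPreserving hB hnd fun s hs ↦ ?_, hφ.det_eq_one fun s hs ↦ ?_⟩
    · obtain ⟨ε, hε, a, b, ha, hb, rfl⟩ := hχ
      refine IsWordIn.trans ?_ ?_
      · exact IsWordIn.of_mem ⟨a, ε, hε, ha, rfl⟩
      · exact IsWordIn.of_mem ⟨b, ε, hε, hb, rfl⟩
    · obtain ⟨ε, hε, a, b, ha, hb, rfl⟩ := hs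
      rw [LinearMap.BilinForm.IsometryEquiv.isOrientationPreserving_trans_iff hB hnd,
        isOrientationPreserving_normTwoReflectionEquiv_iff _ hB hnd, isOrientationPreserving_normTwoReflectionEquiv_iff _ hB hnd]
    · obtain ⟨ε, hε, a, b, ha, hb, rfl⟩ := hs
      rw [IsometryEquiv.det_trans_eq_mul, det_normTwoReflectionEquiv _ hB, det_normTwoReflectionEquiv _ hB]
      norm_num
  · rintro ⟨hφ, h₁, h₂⟩
    obtain ⟨l, hl, hlφ⟩ := hφ.exists_list_of_symm_mem (reflections_symm_mem_and_det' hB).1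
    have hl' : ∀ s ∈ l, s ∈ {ψ : B.IsometryEquiv B | ∃ (r : W) (hr : B r r = 1 + 1), ψ = normTwoReflectionEquiv hB r 1 hr (by norm_num)} ∨
        s ∈ {ψ : B.IsometryEquiv B | ∃ (r : W) (hr : B r r = -1 + -1), ψ = normTwoReflectionEquiv hB r (-1) hr (by norm_num)} := by
      intro s hs
      obtain ⟨r, ε, hε, hr, rfl⟩ := hl s hs
      rcases mul_self_eq_one_iff.1 hε with rfl | rfl
      exacts [Or.inl ⟨r, hr, rfl⟩, Or.inr ⟨r, hr, rfl⟩]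
    obtain ⟨l₁, l₂, hl₁, hl₂, -, hsort⟩ := exists_wordProd_eq_wordProd_append hB (by norm_num) (by norm_num) l hl'
    have hφeq : φ = (wordProd l₁).trans (wordProd l₂) :=
      DFunLike.ext _ _ fun v ↦ by rw [← hlφ, hsort, wordProd_append_apply, LinearMap.BilinForm.IsometryEquiv.trans_apply]
    -- `χ` is the parity of the `(+2)`-letters, `det` the parity of all letters
    have hO₁ : (wordProd l₁).IsOrientationPreserving ↔ Even l₁.length :=
      isOrientationPreserving_wordProd_iff_even_of_forall_not hB hnd l₁ fun s hs ↦ by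
        obtain ⟨r, hr, rfl⟩ := hl₁ s hs
        rw [isOrientationPreserving_normTwoReflectionEquiv_iff _ hB hnd]
        norm_num
    have hO₂ : (wordProd l₂).IsOrientationPreserving :=
      isOrientationPreserving_wordProd_of_forall hB hnd l₂ fun s hs ↦ by
        obtain ⟨r, hr, rfl⟩ := hl₂ s hs
        exact (isOrientationPreserving_normTwoReflectionEquiv_iff _ hB hnd r (-1) hr _).2 rfl
    have he₁ : Even l₁.length := by
      rw [hφeq, LinearMap.BilinForm.IsometryEquiv.isOrientationPreserving_trans_iff hB hnd] at h₁
      exact hO₁.1 (h₁.1 hO₂)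
    have he₂ : Even l₂.length := by
      rw [hφeq, IsometryEquiv.det_trans_eq_mul,
        det_wordProd_eq_neg_one_pow l₁ (fun s hs ↦ by obtain ⟨r, hr, rfl⟩ := hl₁ s hs; exact det_normTwoReflectionEquiv _ hB r 1 hr _),
        det_wordProd_eq_neg_one_pow l₂ (fun s hs ↦ by obtain ⟨r, hr, rfl⟩ := hl₂ s hs; exact det_normTwoReflectionEquiv _ hB r (-1) hr _),
        he₁.neg_one_pow, mul_one] at h₂
      rcases Nat.even_or_odd l₂.length with h | h
      · exact h
      · rw [h.neg_one_pow] at h₂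
        norm_num at h₂
    refine (((isWordIn_pairs_wordProd_of_even l₁ hl₁ he₁).mono ?_).trans
      ((isWordIn_pairs_wordProd_of_even l₂ hl₂ he₂).mono ?_)).congr fun v ↦ by rw [hφeq]
    · rintro χ ⟨s, ⟨a, ha, rfl⟩, t, ⟨b, hb, rfl⟩, rfl⟩
      exact ⟨1, by norm_num, a, b, ha, hb, rfl⟩
    · rintro χ ⟨s, ⟨a, ha, rfl⟩, t, ⟨b, hb, rfl⟩, rfl⟩
      exact ⟨-1, by norm_num, a, b, ha, hb, rfl⟩

omit [Module.Finite ℤ W] [Module.Free ℤ W] in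
/-- **`SRef₊(Λ) ⊆ SRef(Λ)` made explicit**: a word in like-sign pairs is a word in arbitrary pairs of `(±2)`-reflections.
[cite: Markman2023GeneralizedKummers, §7 (opening paragraph)] -/
theorem IsWordIn.reflectionPairs_of_likeSignReflectionPairs (hB : B.IsSymm) {φ : B.IsometryEquiv B}
    (hφ : IsWordIn {χ : B.IsometryEquiv B | ∃ (ε : ℤ) (hε : ε * ε = 1) (a b : W) (ha : B a a = ε + ε) (hb : B b b = ε + ε),
        χ = (normTwoReflectionEquiv hB a ε ha hε).trans (normTwoReflectionEquiv hB b ε hb hε)} φ) :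
    IsWordIn {χ : B.IsometryEquiv B | ∃ (a b : W) (ε₁ ε₂ : ℤ) (hε₁ : ε₁ * ε₁ = 1) (hε₂ : ε₂ * ε₂ = 1) (ha : B a a = ε₁ + ε₁)
        (hb : B b b = ε₂ + ε₂), χ = (normTwoReflectionEquiv hB a ε₁ ha hε₁).trans (normTwoReflectionEquiv hB b ε₂ hb hε₂)} φ := by
  refine hφ.mono ?_
  rintro χ ⟨ε, hε, a, b, ha, hb, h⟩
  exact ⟨a, b, ε, ε, hε, hε, ha, hb, h⟩

end Parity

end Literature.Topology.FourManifolds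

end
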